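import Summits.ResolutionOfSingularities.ResolutionOfSingularities.Theorems.FrobeniusClosingSteerK7HatWords
import Mathlib.Data.Fin.VecNotation
import Literature.AlgebraicGeometry.Resolution.AdicCompletionRegular
import Literature.AlgebraicGeometry.Resolution.RsopMonomialIdeals
import Literature.AlgebraicGeometry.Resolution.RegularLocalRingsQuotient
import Literature.AlgebraicGeometry.Resolution.LogRegularCompleteStructure
import Literature.RingTheory.HilbertSamuel.DirectrixFlatMonotone
import HarnessLib

/-!
# Crux `Steer` (stmt-ResolutionOfSingularities-16345), chain W4.1 — K-β7-hat support word S0 `HatCoordinates` and crux piece W3 `BranchConclusion` PROVED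

OURS (campaign `res-hironaka`, rung L ★L-G4, slot W4.1). The word W3 `BranchConclusion` is the fifth piece of res-L0-w41-idea-1 g12's
K-β7-HAT SIGNATURES `L/res-L0-w41-idea-1/K7HatWords-idea-1-g12.lean` cbdb8a4f311bfcb9 (memo `CANONICAL-CLEANING-g10.md` §12.3 (5) / §12.5 (a);
res-L0-w41-plan-1 RULING 237(b): «W3 → res-D-pv-035»), consumed by the PROVED assembly
`formalCentreDescent_of : HatFrame → BranchTransfer → BranchObstruction → BranchConclusion → FormalCentreDescent` (binder hβ6′ of the β-leaf).
This file proves `theorem branchConclusion_holds : BranchConclusion`. Replaces the role of no printed item; NOT a statement of the manuscript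
under review [claim: Hironaka2017, status: under-review]; candidates' bookkeeping, AI-produced, weaker than expert review; counted 0.

STATEMENT (W3). `S = R i` regular local of dimension `4` with r.s.o.p. `(x, y, z, w)`; `ι : S →+* T` an `IsHatOf`-presentation (so `𝔪_S T = 𝔪_T`)
with a FRAME `e : T ≃+* Ŝ = AdicCompletion 𝔪_S S` over `S`; formal coordinates `z′ ≡ ι z`, `w′ ≡ ι w (mod (x, y)T)`; `P₁ := (ι x, z′, w′)`,
`Q₀ := P₁ ∩ S`. IF `Q₀ T = P₁` THEN `P₁ = (x, z″, w″) T` for some `z″ ≡ z`, `w″ ≡ w (mod (x, y))` in `S`.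

KERNEL PROOF (`branchConclusion_core`, over an abstract hat; every input is a tree theorem):
* FRAME: `ι = e⁻¹ ∘ algebraMap`, hence FAITHFUL FLATNESS ON IDEALS `(I T) ∩ S = I`
  (`Literature.RingTheory.HilbertSamuel.comap_map_adicCompletion_eq`, Matsumura 8.14 + 7.5 (ii), transported by `Ideal.comap_map_of_bijective`),
  and `T` regular local of dimension `4` (`isRegularLocalRing_adicCompletion`, `ringKrullDim_adicCompletion`, transported along `e`);
* `𝔪_T = 𝔪_S T = (ι x, ι y, z′, w′)` (the congruences), so `(ι x, z′, w′, ι y)` is a regular system of parameters of `T`: `P₁` is PRIME and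
  `ι y ∉ P₁` (`IsRsopPart.isPrime_span_range`, `IsRsopPart.not_mem_span_image`, Matsumura 14.2/14.3);
* `(Q₀ + (x, y)) T = P₁ + (ι x, ι y) = 𝔪_T = 𝔪_S T`, so by faithful flatness `Q₀ + (x, y) = 𝔪_S`; write `z = z″ + m`, `w = w″ + m′` with
  `z″, w″ ∈ Q₀`, `m, m′ ∈ (x, y)`;
* `(x, z″, w″, y)` is a regular system of parameters of `S`, so `Q₁ := (x, z″, w″) ≤ Q₀` is prime with `dim S ⧸ Q₁ + 3 = 4`
  (`IsRsopPart.ringKrullDim_quotient_add`); `y ∉ Q₀` (as `ι y ∉ P₁`), so `Q₀ ≠ 𝔪_S`; a chain `Q₁ < Q₀ < 𝔪_S` would force `dim S ⧸ Q₁ ≥ 2`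
  (`LogRegularCompleteStructure.succ_le_ringKrullDim_quotient_of_lt`); hence `Q₀ = Q₁` and `P₁ = Q₀ T = (x, z″, w″) T`.
No characteristic, parity, excellence or cone hypothesis is used (as the word's docstring says); regularity of `R i ⧸ Q₀` drops out.

WORDS. `IsHatOf`, `HatCoordinates`, `BranchConclusion` are the TREE words of `…Theorems.FrobeniusClosingSteerK7HatWords` (res-D-pv-035 on RULING
241(c); bodies byte-identical to idea-1 cbdb8a4f311bfcb9), imported and `open`ed: `hatCoordinates_holds : HatCoordinates` and
`branchConclusion_holds : BranchConclusion` elaborate against the tree words themselves.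
[cite: Matsumura1987, Thm. 8.14, Thm. 14.2, Thm. 15.1] [folklore]
bears_on: LADDER-RESOLUTION L ★L-G4 W4.1 (crux `Steer`, β-leaf binder hβ6′ `FormalCentreDescent`, piece W3).
-/

noncomputable section

set_option linter.dupNamespace false
set_option autoImplicit false

open IsLocalRing

namespace Summit.ResolutionOfSingularities.ResolutionOfSingularities.Theorems.SwitchingDichotomy.K7HatBranchConclusion

open Literature.AlgebraicGeometry.Resolution
open Summit.ResolutionOfSingularities.ResolutionOfSingularities.Theorems.SwitchingDichotomy.K7Hat


/-! ## Small generic helpers -/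

section RangeVec

variable {α : Type}

/-- `range ![a] = {a}`. [folklore] -/
theorem range_vec1 (a : α) : Set.range ![a] = {a} := by
  rw [Matrix.range_cons_empty]

/-- `range ![a, b, c] = {a, b, c}`. [folklore] -/
theorem range_vec3 (a b c : α) : Set.range ![a, b, c] = {a, b, c} := by
  simp only [Matrix.range_cons, Matrix.range_empty, Set.union_empty, Set.singleton_union]

/-- `range ![a, b, c, d] = {a, b, c, d}`. [folklore] -/
theorem range_vec4 (a b c d : α) : Set.range ![a, b, c, d] = {a, b, c, d} := by
  simp only [Matrix.range_cons, Matrix.range_empty, Set.union_empty, Set.singleton_union]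

end RangeVec

section Helpers

variable {A : Type} [CommRing A]

/-- If `c' - c, d' - d ∈ (a, b)` then `(a, b, c', d') ≤ (a, b, c, d)`. [folklore] -/
theorem span_quad_le_of_sub_mem {a b c d c' d' : A} (hc : c' - c ∈ Ideal.span {a, b})
    (hd : d' - d ∈ Ideal.span {a, b}) : Ideal.span {a, b, c', d'} ≤ Ideal.span {a, b, c, d} := by
  have hab : Ideal.span ({a, b} : Set A) ≤ Ideal.span {a, b, c, d} :=
    Ideal.span_mono fun t ht => by
      simp only [Set.mem_insert_iff, Set.mem_singleton_iff] at ht ⊢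
      tauto
  rw [Ideal.span_le]
  intro t ht
  simp only [Set.mem_insert_iff, Set.mem_singleton_iff] at ht
  rcases ht with rfl | rfl | rfl | rfl
  · exact Ideal.subset_span (by simp)
  · exact Ideal.subset_span (by simp)
  · rw [show t = (t - c) + c by ring]
    exact add_mem (hab hc) (Ideal.subset_span (by simp))
  · rw [show t = (t - d) + d by ring]
    exact add_mem (hab hd) (Ideal.subset_span (by simp))

/-- If `c' - c, d' - d ∈ (a, b)` then `(a, b, c', d') = (a, b, c, d)`. [folklore] -/
theorem span_quad_eq_of_sub_mem {a b c d c' d' : A} (hc : c' - c ∈ Ideal.span {a, b})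
    (hd : d' - d ∈ Ideal.span {a, b}) : Ideal.span {a, b, c', d'} = Ideal.span {a, b, c, d} := by
  refine le_antisymm (span_quad_le_of_sub_mem hc hd) (span_quad_le_of_sub_mem ?_ ?_)
  · rw [show c - c' = -(c' - c) by ring]; exact neg_mem hc
  · rw [show d - d' = -(d' - d) by ring]; exact neg_mem hd

/-- Reordering: `(a, c, d, b) = (a, b, c, d)` as ideals. [folklore] -/
theorem span_reorder (a b c d : A) : Ideal.span ({a, c, d, b} : Set A) = Ideal.span {a, b, c, d} := by
  congr 1
  ext t
  simp only [Set.mem_insert_iff, Set.mem_singleton_iff]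
  tauto

/-- A prime strictly below a prime which is not the maximal ideal has coheight `≥ 2`: a chain `Q < P < 𝔪`.
(Same argument as `…SteerBetaLegality.two_le_ringKrullDim_quotient_of_lt`, restated to keep the imports light.) [folklore] -/
theorem two_le_ringKrullDim_quotient_of_lt' [IsLocalRing A] {Q P : Ideal A} [Q.IsPrime] [hP : P.IsPrime]
    (hQP : Q < P) (hne : P ≠ maximalIdeal A) : (2 : WithBot ℕ∞) ≤ ringKrullDim (A ⧸ Q) := by
  have hlt : P < maximalIdeal A := lt_of_le_of_ne (IsLocalRing.le_maximalIdeal hP.ne_top) hne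
  have h0 : ((0 : ℕ) : WithBot ℕ∞) ≤ ringKrullDim (A ⧸ maximalIdeal A) := by
    haveI : Nontrivial (A ⧸ maximalIdeal A) := Ideal.Quotient.nontrivial_iff.mpr (maximalIdeal.isMaximal A).ne_top
    exact_mod_cast ringKrullDim_nonneg_of_nontrivial
  have h1 := LogRegularCompleteStructure.succ_le_ringKrullDim_quotient_of_lt hlt 0 h0
  have h2 := LogRegularCompleteStructure.succ_le_ringKrullDim_quotient_of_lt hQP 1 h1
  exact_mod_cast h2

/-- Arithmetic in `WithBot ℕ∞`: `n + 3 = 4` and `2 ≤ n` are incompatible. [folklore] -/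
theorem not_two_le_of_add_three_eq_four {n : ℕ} (h : (n : WithBot ℕ∞) + 3 = 4)
    (h2 : (2 : WithBot ℕ∞) ≤ (n : WithBot ℕ∞)) : False := by
  have h' : ((n + 3 : ℕ) : WithBot ℕ∞) = ((4 : ℕ) : WithBot ℕ∞) := by push_cast; exact h
  have h2' : ((2 : ℕ) : WithBot ℕ∞) ≤ (n : WithBot ℕ∞) := by exact_mod_cast h2
  have e1 : n + 3 = 4 := by exact_mod_cast h'
  have e2 : 2 ≤ n := by exact_mod_cast h2'
  omega

end Helpers

/-! ## The core statement over an abstract hat -/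

section Core

variable {S T : Type} [CommRing S] [IsLocalRing S] [CommRing T] [IsLocalRing T]

/-- **S0, core form** (the T-side of both S0 and W3). `S` regular local of dimension `4` with r.s.o.p. `(x, y, z, w)`; `ι : S →+* T` with
`𝔪_S T = 𝔪_T` and a FRAME `e : T ≃+* Ŝ` over `S`; `z′ ≡ ι z`, `w′ ≡ ι w (mod (x, y)T)`. THEN: faithful flatness on ideals `(I T) ∩ S = I`; `T` is regular
local of dimension `4`; `𝔪_T = (ι x, ι y, z′, w′)`; `(ι x, z′, w′, ι y)` and `(ι x, z′, w′)` are (parts of) regular systems of parameters of `T`; hence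
`P₁ = (ι x, z′, w′)` is prime, `ι y ∉ P₁`, `T ⧸ P₁` is regular local and `dim T ⧸ P₁ + 3 = 4`. [cite: Matsumura1987, Thm. 8.14, Thm. 14.2, Thm. 15.1] -/
theorem hatCoordinates_core (ι : S →+* T) (e : T ≃+* AdicCompletion (maximalIdeal S) S)
    (x y z w : S) (z' w' : T) (hreg : IsRegularLocalRing S) (hdim : ringKrullDim S = 4)
    (hmax : (maximalIdeal S).map ι = maximalIdeal T)
    (he : ∀ a : S, e (ι a) = algebraMap S (AdicCompletion (maximalIdeal S) S) a)
    (hspan : Ideal.span {x, y, z, w} = maximalIdeal S)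
    (hz : z' - ι z ∈ (Ideal.span {x, y}).map ι) (hw : w' - ι w ∈ (Ideal.span {x, y}).map ι) :
    (∀ I : Ideal S, (I.map ι).comap ι = I) ∧ IsRegularLocalRing T ∧ ringKrullDim T = 4 ∧
      Ideal.span {ι x, ι y, z', w'} = maximalIdeal T ∧ IsRsopPart ![ι x, z', w', ι y] ∧ IsRsopPart ![ι x, z', w'] ∧
      (Ideal.span ({ι x, z', w'} : Set T)).IsPrime ∧ ι y ∉ Ideal.span ({ι x, z', w'} : Set T) ∧
      IsRegularLocalRing (T ⧸ Ideal.span ({ι x, z', w'} : Set T)) ∧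
      ringKrullDim (T ⧸ Ideal.span ({ι x, z', w'} : Set T)) + 3 = 4 := by
  classical
  haveI := hreg
  -- ### the frame: `ι = e⁻¹ ∘ algebraMap`, faithful flatness on ideals, `T` regular of dimension `4`
  have hι : ι = (e.symm : AdicCompletion (maximalIdeal S) S →+* T).comp
      (algebraMap S (AdicCompletion (maximalIdeal S) S)) := by
    refine RingHom.ext fun a => ?_
    rw [RingHom.comp_apply, RingHom.coe_coe, ← he a, RingEquiv.symm_apply_apply]
  have hFF : ∀ I : Ideal S, (I.map ι).comap ι = I := by
    intro I
    rw [hι, ← Ideal.map_map, ← Ideal.comap_comap,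
      Ideal.comap_map_of_bijective (e.symm : AdicCompletion (maximalIdeal S) S →+* T)
        (by simpa using e.symm.bijective)]
    exact Literature.RingTheory.HilbertSamuel.comap_map_adicCompletion_eq S I
  haveI hTreg : IsRegularLocalRing T := by
    haveI := isRegularLocalRing_adicCompletion S
    exact IsRegularLocalRing.of_ringEquiv e.symm
  have hTdim : ringKrullDim T = 4 := by
    rw [ringKrullDim_eq_of_ringEquiv e, ringKrullDim_adicCompletion, hdim]
  -- ### `𝔪_T = (ι x, ι y, z', w')`
  have hmapxy : (Ideal.span {x, y}).map ι = Ideal.span {ι x, ι y} := by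
    rw [Ideal.map_span, Set.image_insert_eq, Set.image_singleton]
  rw [hmapxy] at hz hw
  have hmaxT : Ideal.span {ι x, ι y, z', w'} = maximalIdeal T := by
    rw [← hmax, ← hspan, Ideal.map_span]
    simp only [Set.image_insert_eq, Set.image_singleton]
    exact span_quad_eq_of_sub_mem hz hw
  -- ### `(ι x, z', w', ι y)` and `(ι x, z', w')` are (parts of) regular systems of parameters
  have hu : IsRsopPart ![ι x, z', w', ι y] := by
    refine ⟨hTreg, 0, ![], by rw [hTdim]; norm_cast, ?_⟩
    rw [range_vec4, Matrix.range_empty, Set.union_empty, span_reorder, hmaxT]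
  have hv : IsRsopPart ![ι x, z', w'] := by
    refine ⟨hTreg, 1, ![ι y], by rw [hTdim]; norm_cast, ?_⟩
    rw [range_vec3, range_vec1, Set.union_singleton, ← hmaxT]
    congr 1; ext t; simp only [Set.mem_insert_iff, Set.mem_singleton_iff]; tauto
  have hP₁ : (Ideal.span ({ι x, z', w'} : Set T)).IsPrime := by
    have := hv.isPrime_span_range
    rwa [range_vec3] at this
  have hyP₁ : ι y ∉ Ideal.span ({ι x, z', w'} : Set T) := by
    have h := hu.not_mem_span_image (S := {0, 1, 2}) (i := 3) (by decide)
    have himg : (![ι x, z', w', ι y] '' ({0, 1, 2} : Set (Fin 4))) = {ι x, z', w'} := by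
      simp only [Set.image_insert_eq, Set.image_singleton]
      rfl
    rw [himg] at h
    simpa using h
  have hregQ : IsRegularLocalRing (T ⧸ Ideal.span ({ι x, z', w'} : Set T)) := by
    have := hv.isRegularLocalRing_quotient
    rwa [range_vec3] at this
  have hdimQ : ringKrullDim (T ⧸ Ideal.span ({ι x, z', w'} : Set T)) + 3 = 4 := by
    have := hv.ringKrullDim_quotient_add
    rw [range_vec3, hTdim] at this
    exact_mod_cast this
  exact ⟨hFF, hTreg, hTdim, hmaxT, hu, hv, hP₁, hyP₁, hregQ, hdimQ⟩

/-- **W3, core form.** `S` regular local of dimension `4` with r.s.o.p. `(x, y, z, w)`; `ι : S →+* T` with `𝔪_S T = 𝔪_T` and a FRAME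
`e : T ≃+* Ŝ` over `S`; formal coordinates `z′ ≡ ι z`, `w′ ≡ ι w (mod (x, y)T)`; `P₁ := (ι x, z′, w′)`, `Q₀ := P₁ ∩ S`. If `Q₀ T = P₁` then
`Q₀ = (x, z″, w″)` for some `z″ ≡ z`, `w″ ≡ w (mod (x, y))`, so `P₁ = (x, z″, w″) T`. Route: faithful flatness `I T ∩ S = I`
(`Literature.RingTheory.HilbertSamuel.comap_map_adicCompletion_eq` along `e`); `T` regular of dimension `4` (`isRegularLocalRing_adicCompletion`,
`ringKrullDim_adicCompletion`); `(ι x, z′, w′, ι y)` and `(x, z″, w″, y)` are regular systems of parameters (`IsRsopPart`), so `P₁` is prime with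
`ι y ∉ P₁`, `Q₁ := (x, z″, w″) ≤ Q₀` is prime of coheight `1`, `Q₀ ≠ 𝔪`, and a chain `Q₁ < Q₀ < 𝔪` is impossible. [cite: Matsumura1987, Thm. 8.14, Thm. 14.2] -/
theorem branchConclusion_core (ι : S →+* T) (e : T ≃+* AdicCompletion (maximalIdeal S) S)
    (x y z w : S) (z' w' : T) (hreg : IsRegularLocalRing S) (hdim : ringKrullDim S = 4)
    (hmax : (maximalIdeal S).map ι = maximalIdeal T)
    (he : ∀ a : S, e (ι a) = algebraMap S (AdicCompletion (maximalIdeal S) S) a)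
    (hspan : Ideal.span {x, y, z, w} = maximalIdeal S)
    (hz : z' - ι z ∈ (Ideal.span {x, y}).map ι) (hw : w' - ι w ∈ (Ideal.span {x, y}).map ι)
    (hJ : Ideal.map ι ((Ideal.span {ι x, z', w'}).comap ι) = Ideal.span {ι x, z', w'}) :
    ∃ z'' w'' : S, z'' - z ∈ Ideal.span {x, y} ∧ w'' - w ∈ Ideal.span {x, y} ∧
      Ideal.span {ι x, z', w'} = (Ideal.span {x, z'', w''}).map ι := by
  classical
  haveI := hreg
  obtain ⟨hFF, hTreg, hTdim, hmaxT, hu, hv, hP₁, hyP₁, -, -⟩ :=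
    hatCoordinates_core ι e x y z w z' w' hreg hdim hmax he hspan hz hw
  haveI := hTreg
  haveI := hP₁
  have hmapxy : (Ideal.span {x, y}).map ι = Ideal.span {ι x, ι y} := by
    rw [Ideal.map_span, Set.image_insert_eq, Set.image_singleton]
  -- ### `Q₀ := P₁ ∩ S`; `Q₀ + (x, y) = 𝔪_S` by faithful flatness
  set P₁ : Ideal T := Ideal.span {ι x, z', w'} with hP₁def
  set Q₀ : Ideal S := P₁.comap ι with hQ₀def
  haveI hQ₀ : Q₀.IsPrime := Ideal.IsPrime.comap ι
  have hxy_le : Ideal.span ({ι x, ι y} : Set T) ≤ Ideal.span {ι x, ι y, z', w'} :=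
    Ideal.span_mono fun t ht => by
      simp only [Set.mem_insert_iff, Set.mem_singleton_iff] at ht ⊢; tauto
  have hsup : Q₀ ⊔ Ideal.span {x, y} = maximalIdeal S := by
    have h1 : (Q₀ ⊔ Ideal.span {x, y}).map ι = (maximalIdeal S).map ι := by
      rw [Ideal.map_sup, hJ, hmapxy, hmax, ← hmaxT]
      apply le_antisymm
      · exact sup_le (Ideal.span_mono fun t ht => by
          simp only [Set.mem_insert_iff, Set.mem_singleton_iff] at ht ⊢; tauto) hxy_le
      · rw [Ideal.span_le]
        intro t ht
        simp only [Set.mem_insert_iff, Set.mem_singleton_iff] at ht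
        rcases ht with rfl | rfl | rfl | rfl
        · exact Ideal.mem_sup_left (Ideal.subset_span (by simp))
        · exact Ideal.mem_sup_right (Ideal.subset_span (by simp))
        · exact Ideal.mem_sup_left (Ideal.subset_span (by simp))
        · exact Ideal.mem_sup_left (Ideal.subset_span (by simp))
    have h2 := congrArg (Ideal.comap ι) h1
    simp only [hFF] at h2
    exact h2
  -- ### `z = z'' + m`, `w = w'' + m'` with `z'', w'' ∈ Q₀`, `m, m' ∈ (x, y)`
  have hzm : z ∈ Q₀ ⊔ Ideal.span {x, y} := by rw [hsup, ← hspan]; exact Ideal.subset_span (by simp)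
  have hwm : w ∈ Q₀ ⊔ Ideal.span {x, y} := by rw [hsup, ← hspan]; exact Ideal.subset_span (by simp)
  obtain ⟨z'', hz''Q, m, hm, hzsum⟩ := Submodule.mem_sup.mp hzm
  obtain ⟨w'', hw''Q, m', hm', hwsum⟩ := Submodule.mem_sup.mp hwm
  have hz'' : z'' - z ∈ Ideal.span ({x, y} : Set S) := by
    rw [show z'' - z = -m by rw [← hzsum]; ring]; exact neg_mem hm
  have hw'' : w'' - w ∈ Ideal.span ({x, y} : Set S) := by
    rw [show w'' - w = -m' by rw [← hwsum]; ring]; exact neg_mem hm'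
  -- ### S side: `(x, z'', w'', y)` is an r.s.o.p.; `Q₁ := (x, z'', w'')` prime of coheight 1, `Q₁ ≤ Q₀`
  have hspan'' : Ideal.span ({x, y, z'', w''} : Set S) = maximalIdeal S := by
    rw [← hspan]; exact span_quad_eq_of_sub_mem hz'' hw''
  have hv₀ : IsRsopPart ![x, z'', w''] := by
    refine ⟨hreg, 1, ![y], by rw [hdim]; norm_cast, ?_⟩
    rw [range_vec3, range_vec1, Set.union_singleton, ← hspan'']
    congr 1; ext t; simp only [Set.mem_insert_iff, Set.mem_singleton_iff]; tauto
  set Q₁ : Ideal S := Ideal.span {x, z'', w''} with hQ₁def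
  haveI hQ₁ : Q₁.IsPrime := by
    have := hv₀.isPrime_span_range
    rwa [range_vec3] at this
  haveI hQ₁reg : IsRegularLocalRing (S ⧸ Q₁) := by
    have := hv₀.isRegularLocalRing_quotient
    rwa [range_vec3] at this
  obtain ⟨n₁, hn₁⟩ := exists_nat_cast_eq_ringKrullDim (R := S ⧸ Q₁)
  have hQ₁dim : (n₁ : WithBot ℕ∞) + 3 = 4 := by
    have := hv₀.ringKrullDim_quotient_add
    rw [range_vec3, hdim] at this
    rw [← hn₁]
    exact_mod_cast this
  have hQ₁Q₀ : Q₁ ≤ Q₀ := by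
    rw [hQ₁def, Ideal.span_le]
    intro t ht
    simp only [Set.mem_insert_iff, Set.mem_singleton_iff] at ht
    rcases ht with rfl | rfl | rfl
    · show t ∈ P₁.comap ι
      rw [Ideal.mem_comap]
      exact Ideal.subset_span (by simp)
    · exact hz''Q
    · exact hw''Q
  -- ### `Q₀ ≠ 𝔪_S` (as `ι y ∉ P₁`), hence `Q₀ = Q₁`
  have hQ₀ne : Q₀ ≠ maximalIdeal S := by
    intro h
    have hy : y ∈ Q₀ := by rw [h, ← hspan]; exact Ideal.subset_span (by simp)
    exact hyP₁ (Ideal.mem_comap.mp hy)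
  have hQeq : Q₀ = Q₁ := by
    by_contra hne
    have hlt : Q₁ < Q₀ := lt_of_le_of_ne hQ₁Q₀ (Ne.symm hne)
    exact not_two_le_of_add_three_eq_four hQ₁dim (hn₁ ▸ two_le_ringKrullDim_quotient_of_lt' hlt hQ₀ne)
  -- ### conclusion
  refine ⟨z'', w'', hz'', hw'', ?_⟩
  rw [← hJ]
  show Ideal.map ι Q₀ = _
  rw [hQeq]

end Core

/-! ## The discharge of the two words -/

/-- **S0 `HatCoordinates` HOLDS** (support word of the K-β7-hat programme, idea-1 cbdb8a4f311bfcb9): along the frame, `T` is regular local of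
dimension `4`, `(ι x, ι y, z′, w′)` is an r.s.o.p. of `T`, and `P₁ = (ι x, z′, w′)` is a prime with `T ⧸ P₁` regular local of dimension `1`
(`hatCoordinates_core` + `dim T ⧸ P₁ + 3 = 4` read in `ℕ` via `exists_nat_cast_eq_ringKrullDim`). OURS. [cite: Matsumura1987, Thm. 14.2, Thm. 15.1] -/
theorem hatCoordinates_holds : HatCoordinates := by
  intro S T _ _ _ _ ι e x y z w z' w' hreg hdim hhat he hspan hz hw
  obtain ⟨-, hTreg, hTdim, hmaxT, -, -, hP₁, -, hregQ, hdimQ⟩ :=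
    hatCoordinates_core ι e x y z w z' w' hreg hdim hhat.2.2.1 he hspan hz hw
  refine ⟨hTreg, hTdim, hmaxT, hP₁, hregQ, ?_⟩
  haveI := hregQ
  obtain ⟨n, hn⟩ := exists_nat_cast_eq_ringKrullDim (R := T ⧸ Ideal.span ({ι x, z', w'} : Set T))
  rw [hn] at hdimQ ⊢
  have h' : ((n + 3 : ℕ) : WithBot ℕ∞) = ((4 : ℕ) : WithBot ℕ∞) := by push_cast; exact hdimQ
  have e1 : n + 3 = 4 := by exact_mod_cast h'
  have e2 : n = 1 := by omega
  subst e2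
  rfl


/-- **W3 `BranchConclusion` HOLDS** (K-β7-hat crux piece, memo `CANONICAL-CLEANING-g10.md` §12.3 (5) / §12.5 (a); idea-1
`K7HatWords-idea-1-g12.lean` cbdb8a4f311bfcb9): instantiate `branchConclusion_core` at `S = R i` with `𝔪_S T = 𝔪_T` from the `IsHatOf` clause.
No characteristic, parity, excellence or cone hypothesis is used. OURS. [cite: Matsumura1987, Thm. 8.14, Thm. 14.2] -/
theorem branchConclusion_holds : BranchConclusion := by
  intro K _ R i hloc T _ _ ι e x y z w z' w' hreg hdim hhat he hspan hz hw hJ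
  exact branchConclusion_core ι e x y z w z' w' hreg hdim hhat.2.2.1 he hspan hz hw hJ

end Summit.ResolutionOfSingularities.ResolutionOfSingularities.Theorems.SwitchingDichotomy.K7HatBranchConclusion

end
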